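import Summits.QuantumAdvantage.QuantumAdvantage.Theorems.SosSandwichTopHomogeneousFourier
import HarnessLib

/-!
# `K_T`: the top Walsh level of a pseudo-bounded polynomial is a GRAM PAIRING of its SOS data; the homogeneous
# rung follows from ONE contraction estimate on that data

Support file for route `SosSandwich`, crux `PseudoBoundedAA` (stmt-QuantumAdvantage-15237) and its repaired
homogeneous rung `HomogeneousPBAAT` (stmt-QuantumAdvantage-27399).  The degree-free rung `maxInf ≥ 4·Var²` holds on the
quantum class `Q_T` (tree: `QueryTopLevel.queryHomogeneousRung`, Escudero Gutiérrez Cor 1.7, proved through the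
creation-operator CONTRACTION `QueryTopLevel.sum_norm_sq_gam_finalState_le` and the pairing `pairing_eq`) and is
REFUTED on the SOS class `K_T` (`not_HomogeneousPBAA`: address family, `Inf = 16 Var²/T`).  This route-independent file
transports the same mechanism to `K_T` and isolates the one estimate it needs there:

* §1 `cubeFourierCoeff_sq_top` — `deg q ≤ T`, `|U| = 2T` ⟹ `(q²)^(U) = Σ_{R ⊆ U, |R| = T} q̂(R) q̂(U ∖ R)`.
* §2 `cubeFourierCoeff_top_eq_pairing` — for `p = Σ_j q_j²` on the cube: `p̂(U) = B_q(U) := Σ_j Σ_R q̂_j(R) q̂_j(U∖R)`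
  (`K_T` form of `QueryTopLevel.cubeFourierCoeff_acceptProb_eq_topCoeff`); `cubeFourierCoeff_top_eq_neg_pairing` —
  if also `1 − p = Σ_j r_j²` then `p̂(U) = −B_r(U)`: the accept and reject Gram pairings CANCEL at the top level (the
  trace of unitarity `Σ_{S⊔S'=U}⟨v_S, v_{S'}⟩ = 0` on `K_T`).
* §3 `pairing_sum_comm` (`Σ_U c_U B(U) = Σ_j Σ_{|R|=T} a_j(R) Γ_j(R)`, `Γ_j(R) = Σ_{U ⊇ R} c_U a_j(U∖R)` — the creation
  functional on SOS data), `sq_pairing_le` (Cauchy–Schwarz), `sum_sq_topCoeff_le_one` (Parseval, `E p ≤ 1`).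
* §4 **`topWeight_sq_le_of_contraction`**: if the data obey the CONTRACTION ESTIMATE with constant `K`
  (`Σ_{j,R} Γ_j(R)² ≤ K·M` whenever `Σ_{U ∋ k} c_U² ≤ M` for all `k`) then `∃ k, 4 (W^{=2T}[p])² ≤ K·Inf_k[p]`;
  **`homogeneousRung_of_contraction`**: for top-homogeneous `p`, `∃ k, 4 Var[p]² ≤ K·Inf_k[p]`.
  CALIBRATION: `K = 1` on `Q_T` (the tree's contraction chain), so §4 returns `queryHomogeneousRung`; on the address
  family the weights `c_U = p̂(U)` used in §4 force `K ≥ T/2` (hand computation: `Γ(R) = Ĝ(R)/4`,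
  `Σ_R Γ(R)² = 1/8 = (T/2)·max_k Σ_{U∋k} p̂(U)²`; the Cauchy–Schwarz step is then an equality, only the Parseval step
  `E p ≤ 1` loses the factor `E p = 1/2`), so no `T`-free `K` exists on `K_T`, and a bound `K ≤ A·T` would give the
  conjectured sharp ORDER `maxInf ≥ (4/A)·Var²/T`.  The companion file `SosSandwichPseudoBoundedTopPairingRung` derives
  the route item `HomogeneousPBAAT` from a uniform bound `K ≤ A·T^a`.  Honest label: identity + reduction; NO estimate of
  `K` on `K_T ∖ Q_T` is proved.

All proved, no named facts; axioms `propext`, `Classical.choice`, `Quot.sound`.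
Sources: EscuderoGutierrez2023 (arXiv:2304.06713) Thm 1.6 / Cor 1.7, §4.2; ODonnell2014 §1.4; KaniewskiLeeDewolf2015 Def. 7.
-/

set_option linter.dupNamespace false

noncomputable section

namespace Summit.QuantumAdvantage.QuantumAdvantage.Theorems.SosSandwich

open Finset MvPolynomial Literature.Computability.QuantumComplexity
open Literature.Computability.Complexity.LowDegree Literature.Probability.RandomGraphs.LowDegree
open scoped symmDiff

namespace TopPairing

variable {N : ℕ}

/-! ### §1 The top level of a square -/

/-- `U ∖ S ⊆ S ∆ U`. [folklore] -/
theorem sdiff_subset_symmDiff (S U : Finset (Fin N)) : U \ S ⊆ S ∆ U := by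
  intro i hi
  rw [Finset.mem_sdiff] at hi
  rw [Finset.mem_symmDiff]
  exact Or.inr ⟨hi.1, hi.2⟩

/-- If `|S| ≤ T`, `|U| = 2T` and `|S ∆ U| ≤ T` then `|S| = T` and `S ⊆ U`. [folklore] -/
theorem card_eq_and_subset_of_symmDiff {T : ℕ} {S U : Finset (Fin N)} (hS : S.card ≤ T) (hU : U.card = 2 * T)
    (hSU : (S ∆ U).card ≤ T) : S.card = T ∧ S ⊆ U := by
  have h1 : (U \ S).card ≤ T := (Finset.card_le_card (sdiff_subset_symmDiff S U)).trans hSU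
  have h2 : U.card - S.card ≤ (U \ S).card := Finset.le_card_sdiff S U
  have h3 : (U \ S).card + (U ∩ S).card = U.card := Finset.card_sdiff_add_card_inter U S
  have h4 : (U ∩ S).card ≤ S.card := Finset.card_le_card Finset.inter_subset_right
  have hcardS : S.card = T := by omega
  have hinter : (U ∩ S).card = S.card := by omega
  have hsub : U ∩ S = S := Finset.eq_of_subset_of_card_le Finset.inter_subset_right hinter.ge
  exact ⟨hcardS, by rw [← hsub]; exact Finset.inter_subset_left⟩

/-- **The top Walsh level of a square.**  If `q` has total degree `≤ T` and `|U| = 2T`, then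
`(q²)^(U) = Σ_{R ⊆ U, |R| = T} q̂(R)·q̂(U ∖ R)`: in the convolution formula `(q·q)^(U) = Σ_S q̂(S) q̂(S ∆ U)`
only the complementary top-level pairs survive the degree bound. [cite: ODonnell2014, §1.4] -/
theorem cubeFourierCoeff_sq_top {T : ℕ} (q : MvPolynomial (Fin N) ℝ) (hq : q.totalDegree ≤ T)
    {U : Finset (Fin N)} (hU : U.card = 2 * T) :
    cubeFourierCoeff (fun x => evalBool q x ^ 2) U =
      ∑ R ∈ Finset.univ.filter (fun R : Finset (Fin N) => R.card = T ∧ R ⊆ U),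
        cubeFourierCoeff (evalBool q) R * cubeFourierCoeff (evalBool q) (U \ R) := by
  have hmul : (fun x => evalBool q x ^ 2) = fun x => evalBool q x * evalBool q x := funext fun x => sq _
  rw [hmul, cubeFourierCoeff_mul]
  symm
  rw [← Finset.sum_subset (Finset.subset_univ
      (Finset.univ.filter (fun R : Finset (Fin N) => R.card = T ∧ R ⊆ U)))]
  · refine Finset.sum_congr rfl fun R hR => ?_
    rw [Finset.mem_filter] at hR
    rw [symmDiff_of_le hR.2.2]
  · intro S _ hS
    rw [Finset.mem_filter, not_and] at hS
    by_cases hScard : T < S.card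
    · rw [cubeFourierCoeff_evalBool_eq_zero hq hScard, zero_mul]
    · by_cases hSU : T < (S ∆ U).card
      · rw [cubeFourierCoeff_evalBool_eq_zero hq hSU, mul_zero]
      · exfalso
        obtain ⟨h1, h2⟩ := card_eq_and_subset_of_symmDiff (not_lt.mp hScard) hU (not_lt.mp hSU)
        exact hS (Finset.mem_univ S) ⟨h1, h2⟩

/-! ### §2 The top level of a pseudo-bounded polynomial is the Gram pairing of its SOS data -/

/-- **Top Walsh coefficients of `p = Σ_j q_j²` (`deg q_j ≤ T`) at `|U| = 2T`**:
`p̂(U) = Σ_j Σ_{R ⊆ U, |R| = T} q̂_j(R) q̂_j(U ∖ R)` — the Gram pairing of the top-level coefficient vectors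
`(q̂_j(R))_j` and `(q̂_j(U∖R))_j`. (The `K_T` form of `QueryTopLevel.cubeFourierCoeff_acceptProb_eq_topCoeff`.)
[cite: EscuderoGutierrez2023, §4.2] [cite: KaniewskiLeeDewolf2015, Def. 7] -/
theorem cubeFourierCoeff_top_eq_pairing {T m : ℕ} (q : Fin m → MvPolynomial (Fin N) ℝ)
    (hq : ∀ j, (q j).totalDegree ≤ T) (p : MvPolynomial (Fin N) ℝ)
    (hp : ∀ x, evalBool p x = ∑ j, evalBool (q j) x ^ 2) {U : Finset (Fin N)} (hU : U.card = 2 * T) :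
    cubeFourierCoeff (evalBool p) U =
      ∑ j, ∑ R ∈ Finset.univ.filter (fun R : Finset (Fin N) => R.card = T ∧ R ⊆ U),
        cubeFourierCoeff (evalBool (q j)) R * cubeFourierCoeff (evalBool (q j)) (U \ R) := by
  have hfun : evalBool p = fun x => ∑ j ∈ Finset.univ, (fun j x => evalBool (q j) x ^ 2) j x :=
    funext fun x => hp x
  rw [hfun, cubeFourierCoeff_sum]
  exact Finset.sum_congr rfl fun j _ => cubeFourierCoeff_sq_top (q j) (hq j) hU

/-- **Sandwich antisymmetry at the top level.**  If moreover `1 − p = Σ_j r_j²` on the cube (`deg r_j ≤ T`,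
`T ≥ 1`), then for `|U| = 2T` the reject pairing is MINUS the accept pairing:
`p̂(U) = −Σ_j Σ_{R ⊆ U, |R|=T} r̂_j(R) r̂_j(U ∖ R)` (since `(1 − p)^(U) = −p̂(U)` for `U ≠ ∅`).  This is the trace
left on `K_T` by unitarity (`Σ_{S ⊔ S' = U} ⟨v_S, v_{S'}⟩ = 0` for a sphere map). [cite: EscuderoGutierrez2023, §4.2] -/
theorem cubeFourierCoeff_top_eq_neg_pairing {T m : ℕ} (hT : 1 ≤ T) (r : Fin m → MvPolynomial (Fin N) ℝ)
    (hr : ∀ j, (r j).totalDegree ≤ T) (p : MvPolynomial (Fin N) ℝ)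
    (hp : ∀ x, 1 - evalBool p x = ∑ j, evalBool (r j) x ^ 2) {U : Finset (Fin N)} (hU : U.card = 2 * T) :
    cubeFourierCoeff (evalBool p) U =
      -∑ j, ∑ R ∈ Finset.univ.filter (fun R : Finset (Fin N) => R.card = T ∧ R ⊆ U),
        cubeFourierCoeff (evalBool (r j)) R * cubeFourierCoeff (evalBool (r j)) (U \ R) := by
  have hU0 : U ≠ ∅ := by
    intro h; rw [h, Finset.card_empty] at hU; omega
  have hfun : (fun x => (fun _ : Fin N → Bool => (1 : ℝ)) x - evalBool p x) =
      fun x => ∑ j ∈ Finset.univ, (fun j x => evalBool (r j) x ^ 2) j x :=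
    funext fun x => hp x
  have h1 : cubeFourierCoeff (fun x => (fun _ : Fin N → Bool => (1 : ℝ)) x - evalBool p x) U =
      -cubeFourierCoeff (evalBool p) U := by
    rw [cubeFourierCoeff_sub, cubeFourierCoeff_const hU0, zero_sub]
  rw [hfun, cubeFourierCoeff_sum] at h1
  have h2 : ∑ j ∈ Finset.univ, cubeFourierCoeff ((fun j x => evalBool (r j) x ^ 2) j) U =
      ∑ j, ∑ R ∈ Finset.univ.filter (fun R : Finset (Fin N) => R.card = T ∧ R ⊆ U),
        cubeFourierCoeff (evalBool (r j)) R * cubeFourierCoeff (evalBool (r j)) (U \ R) :=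
    Finset.sum_congr rfl fun j _ => cubeFourierCoeff_sq_top (r j) (hr j) hU
  linarith

/-! ### §3 The abstract pairing identity and Cauchy–Schwarz -/

/-- **Pairing identity** (the creation functional on SOS data): for any coefficient family `a` and weights `c`,
`Σ_{|U|=2T} c_U · Σ_j Σ_{R ⊆ U,|R|=T} a_j(R) a_j(U∖R) = Σ_j Σ_{|R|=T} a_j(R) · Σ_{U ⊇ R, |U|=2T} c_U a_j(U∖R)`.
[cite: EscuderoGutierrez2023, proof of Thm 1.6] -/
theorem pairing_sum_comm {m : ℕ} (T : ℕ) (a : Fin m → Finset (Fin N) → ℝ) (c : Finset (Fin N) → ℝ) :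
    ∑ U ∈ Finset.univ.filter (fun U : Finset (Fin N) => U.card = 2 * T),
        c U * ∑ j, ∑ R ∈ Finset.univ.filter (fun R : Finset (Fin N) => R.card = T ∧ R ⊆ U),
          a j R * a j (U \ R) =
      ∑ j, ∑ R ∈ Finset.univ.filter (fun R : Finset (Fin N) => R.card = T),
        a j R * ∑ U ∈ Finset.univ.filter (fun U : Finset (Fin N) => U.card = 2 * T ∧ R ⊆ U),
          c U * a j (U \ R) := by
  -- pull `Σ_j` to the front on the left
  have e1 : ∀ U : Finset (Fin N),
      c U * ∑ j, ∑ R ∈ Finset.univ.filter (fun R : Finset (Fin N) => R.card = T ∧ R ⊆ U), a j R * a j (U \ R) =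
        ∑ j, ∑ R ∈ Finset.univ.filter (fun R : Finset (Fin N) => R.card = T ∧ R ⊆ U),
          c U * (a j R * a j (U \ R)) := by
    intro U
    rw [Finset.mul_sum]
    exact Finset.sum_congr rfl fun j _ => by rw [Finset.mul_sum]
  simp_rw [e1]
  rw [Finset.sum_comm]
  refine Finset.sum_congr rfl fun j _ => ?_
  -- for fixed `j`: exchange `(U, R ⊆ U)` and `(R, U ⊇ R)`
  have e2 : ∀ R : Finset (Fin N),
      a j R * ∑ U ∈ Finset.univ.filter (fun U : Finset (Fin N) => U.card = 2 * T ∧ R ⊆ U), c U * a j (U \ R) =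
        ∑ U ∈ Finset.univ.filter (fun U : Finset (Fin N) => U.card = 2 * T ∧ R ⊆ U),
          c U * (a j R * a j (U \ R)) := by
    intro R
    rw [Finset.mul_sum]
    exact Finset.sum_congr rfl fun U _ => by ring
  simp_rw [e2]
  rw [Finset.sum_comm' (t' := Finset.univ.filter (fun R : Finset (Fin N) => R.card = T))
    (s' := fun R => Finset.univ.filter (fun U : Finset (Fin N) => U.card = 2 * T ∧ R ⊆ U))
    (h := fun U R => by
      simp only [Finset.mem_filter, Finset.mem_univ, true_and]
      tauto)]

/-- **Cauchy–Schwarz for the pairing**: `(Σ_j Σ_{R ∈ F} a_j(R) g_j(R))² ≤ (Σ_j Σ_{R∈F} a_j(R)²)(Σ_j Σ_{R∈F} g_j(R)²)`.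
[folklore] -/
theorem sq_pairing_le {m : ℕ} (F : Finset (Finset (Fin N))) (a g : Fin m → Finset (Fin N) → ℝ) :
    (∑ j, ∑ R ∈ F, a j R * g j R) ^ 2 ≤ (∑ j, ∑ R ∈ F, a j R ^ 2) * (∑ j, ∑ R ∈ F, g j R ^ 2) := by
  rw [← Finset.sum_product (s := Finset.univ) (t := F) (f := fun x => a x.1 x.2 * g x.1 x.2),
    ← Finset.sum_product (s := Finset.univ) (t := F) (f := fun x => a x.1 x.2 ^ 2),
    ← Finset.sum_product (s := Finset.univ) (t := F) (f := fun x => g x.1 x.2 ^ 2)]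
  exact Finset.sum_mul_sq_le_sq_mul_sq _ _ _

/-- **Parseval bound for the top coefficients of SOS data**: if `p = Σ_j q_j²` on the cube and `p ≤ 1` there, then
`Σ_j Σ_{|R| = T} q̂_j(R)² ≤ Σ_j E[q_j²] = E[p] ≤ 1`. [cite: ODonnell2014, §1.4] -/
theorem sum_sq_topCoeff_le_one {T m : ℕ} (q : Fin m → MvPolynomial (Fin N) ℝ) (p : MvPolynomial (Fin N) ℝ)
    (hp : ∀ x, evalBool p x = ∑ j, evalBool (q j) x ^ 2) (hp1 : ∀ x, evalBool p x ≤ 1) :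
    ∑ j, ∑ R ∈ Finset.univ.filter (fun R : Finset (Fin N) => R.card = T),
      cubeFourierCoeff (evalBool (q j)) R ^ 2 ≤ 1 := by
  have h2 : (0 : ℝ) < (2 : ℝ) ^ N := by positivity
  calc ∑ j, ∑ R ∈ Finset.univ.filter (fun R : Finset (Fin N) => R.card = T),
        cubeFourierCoeff (evalBool (q j)) R ^ 2
      ≤ ∑ j, ∑ R, cubeFourierCoeff (evalBool (q j)) R ^ 2 :=
        Finset.sum_le_sum fun j _ =>
          Finset.sum_le_sum_of_subset_of_nonneg (Finset.filter_subset _ _) fun R _ _ => sq_nonneg _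
    _ = ∑ j, (∑ x, evalBool (q j) x ^ 2) / 2 ^ N :=
        Finset.sum_congr rfl fun j _ => sum_cubeFourierCoeff_sq _
    _ = (∑ x, evalBool p x) / 2 ^ N := by
        rw [← Finset.sum_div, Finset.sum_comm]
        congr 1
        exact Finset.sum_congr rfl fun x _ => (hp x).symm
    _ ≤ (∑ _x : Fin N → Bool, (1 : ℝ)) / 2 ^ N := by
        gcongr with x
        exact hp1 x
    _ = 1 := by
        rw [Finset.sum_const, Finset.card_univ, Fintype.card_fun, Fintype.card_bool, Fintype.card_fin,
          nsmul_eq_mul, mul_one]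
        push_cast
        exact div_self (ne_of_gt h2)

/-! ### §4 The rung from a contraction estimate -/

/-- **Top-level weight versus influence on `K_T`, from a contraction estimate.**  Let `p = Σ_j q_j²` on the cube
with `deg q_j ≤ T` and `p ≤ 1` there (`T ≥ 1`, `N ≥ 1`).  Suppose the top-level coefficients of the SOS data obey
the CONTRACTION ESTIMATE with constant `K`: for all real weights `c` on the `2T`-subsets and all `M`, if
`Σ_{|U|=2T, U ∋ k} c_U² ≤ M` for every index `k`, then
`Σ_j Σ_{|R|=T} (Σ_{U ⊇ R, |U|=2T} c_U q̂_j(U ∖ R))² ≤ K·M` (for `T`-query acceptance probabilities this holds with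
`K = 1`: `QueryTopLevel.sum_norm_sq_gam_finalState_le`).  Then some variable has `4·(W^{=2T}[p])² ≤ K·Inf_k[p]`,
`W^{=2T}[p] = Σ_{|U|=2T} p̂(U)²`.  Proof: pair with the extremal weights `c_U = p̂(U)`, §2–§3, Parseval.
CALIBRATION (by hand, not needed below): on the address family of `not_HomogeneousPBAA` (`q = (G(x)+G(x'))/2`, `G`
homogeneous Boolean of degree `T` with all influences `1/T`) the weights `c_U = p̂(U)` give `Σ_R Γ(R)² = (T/2)·M`, so
`K ≥ T/2` is forced there (and the Cauchy–Schwarz step is an equality).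
[cite: EscuderoGutierrez2023, Thm 1.6 (proof)] -/
theorem topWeight_sq_le_of_contraction {T m : ℕ} (hT : 1 ≤ T) (hN : 0 < N) (q : Fin m → MvPolynomial (Fin N) ℝ)
    (hq : ∀ j, (q j).totalDegree ≤ T) (p : MvPolynomial (Fin N) ℝ)
    (hp : ∀ x, evalBool p x = ∑ j, evalBool (q j) x ^ 2) (hp1 : ∀ x, evalBool p x ≤ 1) (K : ℝ)
    (hK : ∀ (c : Finset (Fin N) → ℝ) (M : ℝ),
      (∀ k : Fin N, ∑ U ∈ Finset.univ.filter (fun U : Finset (Fin N) => U.card = 2 * T ∧ k ∈ U), c U ^ 2 ≤ M) →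
      ∑ j, ∑ R ∈ Finset.univ.filter (fun R : Finset (Fin N) => R.card = T),
        (∑ U ∈ Finset.univ.filter (fun U : Finset (Fin N) => U.card = 2 * T ∧ R ⊆ U),
          c U * cubeFourierCoeff (evalBool (q j)) (U \ R)) ^ 2 ≤ K * M) :
    ∃ k : Fin N, 4 * (∑ U ∈ Finset.univ.filter (fun U : Finset (Fin N) => U.card = 2 * T),
        cubeFourierCoeff (evalBool p) U ^ 2) ^ 2 ≤ K * influence k p := by
  have hne : (Finset.univ : Finset (Fin N)).Nonempty := ⟨⟨0, hN⟩, Finset.mem_univ _⟩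
  set B : Finset (Fin N) → ℝ := fun U => cubeFourierCoeff (evalBool p) U with hBdef
  set mk : Fin N → ℝ := fun k =>
    ∑ U ∈ Finset.univ.filter (fun U : Finset (Fin N) => U.card = 2 * T ∧ k ∈ U), B U ^ 2 with hmk
  obtain ⟨k₀, -, hk₀⟩ := Finset.exists_max_image Finset.univ mk hne
  refine ⟨k₀, ?_⟩
  set M := mk k₀ with hMdef
  set V := ∑ U ∈ Finset.univ.filter (fun U : Finset (Fin N) => U.card = 2 * T), B U ^ 2 with hVdef
  -- `4 M ≤ Inf_{k₀}`
  have hMinf : 4 * M ≤ influence k₀ p := by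
    rw [influence_eq_sum_sq_fourier]
    refine mul_le_mul_of_nonneg_left ?_ (by norm_num)
    exact Finset.sum_le_sum_of_subset_of_nonneg
      (fun U hU => by
        rw [Finset.mem_filter] at hU ⊢
        exact ⟨hU.1, hU.2.2⟩)
      fun U _ _ => sq_nonneg _
  -- the top coefficients of the data and the creation functional for the weights `c = B`
  set a : Fin m → Finset (Fin N) → ℝ := fun j R => cubeFourierCoeff (evalBool (q j)) R with hadef
  set g : Fin m → Finset (Fin N) → ℝ := fun j R =>
    ∑ U ∈ Finset.univ.filter (fun U : Finset (Fin N) => U.card = 2 * T ∧ R ⊆ U), B U * a j (U \ R) with hgdef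
  -- pairing: `V = Σ_j Σ_R a_j(R) Γ_j(R)`
  have hpair : V = ∑ j, ∑ R ∈ Finset.univ.filter (fun R : Finset (Fin N) => R.card = T), a j R * g j R := by
    rw [hVdef]
    have e1 : ∀ U ∈ Finset.univ.filter (fun U : Finset (Fin N) => U.card = 2 * T), B U ^ 2 =
        B U * ∑ j, ∑ R ∈ Finset.univ.filter (fun R : Finset (Fin N) => R.card = T ∧ R ⊆ U),
          a j R * a j (U \ R) := by
      intro U hU
      rw [Finset.mem_filter] at hU
      rw [sq]
      congr 1
      exact cubeFourierCoeff_top_eq_pairing q hq p hp hU.2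
    rw [Finset.sum_congr rfl e1, pairing_sum_comm T a B]
  -- Cauchy–Schwarz, Parseval, and the contraction estimate
  have hCS := sq_pairing_le (Finset.univ.filter (fun R : Finset (Fin N) => R.card = T)) a g
  have hPars : ∑ j, ∑ R ∈ Finset.univ.filter (fun R : Finset (Fin N) => R.card = T), a j R ^ 2 ≤ 1 :=
    sum_sq_topCoeff_le_one q p hp hp1
  have hc : ∀ k : Fin N,
      ∑ U ∈ Finset.univ.filter (fun U : Finset (Fin N) => U.card = 2 * T ∧ k ∈ U), B U ^ 2 ≤ M :=
    fun k => hk₀ k (Finset.mem_univ k)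
  have hcontr : ∑ j, ∑ R ∈ Finset.univ.filter (fun R : Finset (Fin N) => R.card = T), g j R ^ 2 ≤ K * M :=
    hK B M hc
  have hg0 : 0 ≤ ∑ j, ∑ R ∈ Finset.univ.filter (fun R : Finset (Fin N) => R.card = T), g j R ^ 2 :=
    Finset.sum_nonneg fun j _ => Finset.sum_nonneg fun R _ => sq_nonneg _
  have ha0 : 0 ≤ ∑ j, ∑ R ∈ Finset.univ.filter (fun R : Finset (Fin N) => R.card = T), a j R ^ 2 :=
    Finset.sum_nonneg fun j _ => Finset.sum_nonneg fun R _ => sq_nonneg _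
  have hKM : 0 ≤ K * M := hg0.trans hcontr
  have hV2 : V ^ 2 ≤ K * M := by
    rw [hpair]
    calc (∑ j, ∑ R ∈ Finset.univ.filter (fun R : Finset (Fin N) => R.card = T), a j R * g j R) ^ 2
        ≤ (∑ j, ∑ R ∈ Finset.univ.filter (fun R : Finset (Fin N) => R.card = T), a j R ^ 2) *
            (∑ j, ∑ R ∈ Finset.univ.filter (fun R : Finset (Fin N) => R.card = T), g j R ^ 2) := hCS
      _ ≤ 1 * (K * M) := mul_le_mul hPars hcontr hg0 zero_le_one
      _ = K * M := one_mul _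
  have hK0 : 0 ≤ K ∨ M = 0 := by
    by_cases hM : M = 0
    · exact Or.inr hM
    · have hMpos : 0 < M := lt_of_le_of_ne (Finset.sum_nonneg fun U _ => sq_nonneg _) (Ne.symm hM)
      exact Or.inl (nonneg_of_mul_nonneg_left hKM hMpos)
  rcases hK0 with hK0 | hM0
  · calc 4 * V ^ 2 ≤ 4 * (K * M) := by linarith
      _ = K * (4 * M) := by ring
      _ ≤ K * influence k₀ p := mul_le_mul_of_nonneg_left hMinf hK0
  · -- `M = 0`: every top coefficient vanishes, so `V = 0`
    have hV0 : V = 0 := by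
      refine Finset.sum_eq_zero fun U hU => ?_
      rw [Finset.mem_filter] at hU
      have hUne : U.Nonempty := by rw [← Finset.card_pos, hU.2]; omega
      obtain ⟨k, hk⟩ := hUne
      have hmk0 : mk k = 0 :=
        le_antisymm ((hk₀ k (Finset.mem_univ k)).trans hM0.le) (Finset.sum_nonneg fun U _ => sq_nonneg _)
      have hle : B U ^ 2 ≤ mk k :=
        Finset.single_le_sum (f := fun U => B U ^ 2) (fun U _ => sq_nonneg _)
          (Finset.mem_filter.mpr ⟨Finset.mem_univ U, hU.2, hk⟩)
      exact le_antisymm (hle.trans hmk0.le) (sq_nonneg _)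
    have hKinf : K * influence k₀ p = K * (4 * M) + K * (influence k₀ p - 4 * M) := by ring
    rw [hV0]
    have : 0 ≤ K * M := hKM
    rw [hM0] at hMinf
    -- `0 ≤ K · Inf_{k₀}` need not hold for negative `K`; but `M = 0` forces nothing on `K`, so argue directly:
    -- with `M = 0` the contraction hypothesis at `c = 0`, `M' = 1` gives `0 ≤ K`.
    have hK0' : 0 ≤ K := by
      have h := hK (fun _ => 0) 1 (fun k => by simp)
      have h0 : ∑ j, ∑ R ∈ Finset.univ.filter (fun R : Finset (Fin N) => R.card = T),
          (∑ U ∈ Finset.univ.filter (fun U : Finset (Fin N) => U.card = 2 * T ∧ R ⊆ U),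
            (fun _ : Finset (Fin N) => (0 : ℝ)) U * cubeFourierCoeff (evalBool (q j)) (U \ R)) ^ 2 = 0 := by
        simp
      linarith
    have hinf0 : 0 ≤ influence k₀ p := influence_nonneg k₀ p
    nlinarith

/-- **Variance of a top-homogeneous `p` = its top-level weight**: under the Laplacian eigen-equation of order `T ≥ 1`,
`Var[p] = Σ_{|U| = 2T} p̂(U)²` (Parseval for `p − E p`, whose coefficients vanish off level `2T`).
[cite: ODonnell2014, §1.4] -/
theorem boolVariance_eq_topWeight_of_laplacian {T : ℕ} (hT : 1 ≤ T) (p : MvPolynomial (Fin N) ℝ)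
    (hhom : ∀ x : Fin N → Bool, ∑ i : Fin N, (evalBool p x - evalBool p (Function.update x i (!x i))) =
      4 * (T : ℝ) * (evalBool p x - boolAvg (evalBool p))) :
    boolVariance p =
      ∑ U ∈ Finset.univ.filter (fun U : Finset (Fin N) => U.card = 2 * T), cubeFourierCoeff (evalBool p) U ^ 2 := by
  have hV : boolVariance p = (∑ x, (fun y => evalBool p y - boolAvg (evalBool p)) x ^ 2) / 2 ^ N := rfl
  rw [hV, ← sum_cubeFourierCoeff_sq]
  symm
  rw [← Finset.sum_subset (Finset.subset_univ (Finset.univ.filter (fun U : Finset (Fin N) => U.card = 2 * T)))]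
  · refine Finset.sum_congr rfl fun U hU => ?_
    rw [Finset.mem_filter] at hU
    have hU0 : U ≠ ∅ := by
      intro h; rw [h, Finset.card_empty] at hU; omega
    rw [cubeFourierCoeff_sub, cubeFourierCoeff_const hU0, sub_zero]
  · intro U _ hU
    rw [Finset.mem_filter, not_and] at hU
    rw [TopLevelFourier.centred_coeff_eq_zero_of_laplacian T p hhom (hU (Finset.mem_univ U))]
    ring

/-- **The homogeneous rung on `K_T` from a contraction estimate.**  Under the hypotheses of
`topWeight_sq_le_of_contraction`, if `p` is moreover TOP-HOMOGENEOUS of order `T` (the Laplacian eigen-equation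
`Σᵢ (p(x) − p(x⊕eᵢ)) = 4T (p(x) − E p)` of the route's `HomogeneousPBAAT`), then `∃ k, 4·Var[p]² ≤ K·Inf_k[p]`.
With `K = 1` this is the (refuted on `K_T`, proved on `Q_T`) degree-free rung; the address family forces `K ≥ T/2`.
[cite: EscuderoGutierrez2023, Cor 1.7] -/
theorem homogeneousRung_of_contraction {T m : ℕ} (hT : 1 ≤ T) (hN : 0 < N) (q : Fin m → MvPolynomial (Fin N) ℝ)
    (hq : ∀ j, (q j).totalDegree ≤ T) (p : MvPolynomial (Fin N) ℝ)
    (hp : ∀ x, evalBool p x = ∑ j, evalBool (q j) x ^ 2) (hp1 : ∀ x, evalBool p x ≤ 1) (K : ℝ)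
    (hK : ∀ (c : Finset (Fin N) → ℝ) (M : ℝ),
      (∀ k : Fin N, ∑ U ∈ Finset.univ.filter (fun U : Finset (Fin N) => U.card = 2 * T ∧ k ∈ U), c U ^ 2 ≤ M) →
      ∑ j, ∑ R ∈ Finset.univ.filter (fun R : Finset (Fin N) => R.card = T),
        (∑ U ∈ Finset.univ.filter (fun U : Finset (Fin N) => U.card = 2 * T ∧ R ⊆ U),
          c U * cubeFourierCoeff (evalBool (q j)) (U \ R)) ^ 2 ≤ K * M)
    (hhom : ∀ x : Fin N → Bool, ∑ i : Fin N, (evalBool p x - evalBool p (Function.update x i (!x i))) =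
      4 * (T : ℝ) * (evalBool p x - boolAvg (evalBool p))) :
    ∃ k : Fin N, 4 * boolVariance p ^ 2 ≤ K * influence k p := by
  have hvar : boolVariance p =
      ∑ U ∈ Finset.univ.filter (fun U : Finset (Fin N) => U.card = 2 * T), cubeFourierCoeff (evalBool p) U ^ 2 :=
    boolVariance_eq_topWeight_of_laplacian hT p hhom
  rw [hvar]
  exact topWeight_sq_le_of_contraction hT hN q hq p hp hp1 K hK

end TopPairing

end Summit.QuantumAdvantage.QuantumAdvantage.Theorems.SosSandwich

end
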